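import Summits.AnomalousDissipation.AnomalousDissipation.Theorems.WindLineWindyGalerkinSteadyZerothLawGenericLeafNondegeneracyTools
import Summits.AnomalousDissipation.AnomalousDissipation.Theorems.WindLineWindyGalerkinSteadyZerothLawGenericLeafNondegeneracyToolsC
import Literature.Analysis.FluidPDE.TorusClassicalH1Balance

/-!
# Generic leaf-nondegeneracy (stub B of crux `WindLine.WindyGalerkinSteadyZerothLaw`,
# stmt-AnomalousDissipation-11414), tools D: a priori bounds for classical steady states of `NS_ν(F⟦c⟧)`

Helper layer (pure proof file, no definitions).  For an admissible parameter `c ∈ 𝒜` and a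
classical steady state `(u, p)` of `NS_ν(F⟦c⟧)`, `ν > 0`, with mean `û(0) = M`:

* `steady_energy_identity` — `ν ‖∇u‖₂² = ∫ ⟪F⟦c⟧, u⟫` (the kinetic energy of a constant path has
  derivative zero, `IsClassicalNSSolutionOn.energy_balance_holds`);
* `gradNormSq_le_of_steady` — the **`H¹` bound** `‖∇u‖₂² ≤ ‖c‖² / (4π² ν²)` (Parseval for
  `∫⟪f, u⟫` and `‖∇u‖₂²`, Cauchy–Schwarz, `‖𝓕F⟦c⟧‖_{ℓ²} ≤ ‖c‖`);
* `eNormSq_one_cf_stateVec_le` — hence `‖û°‖²_{H¹} ≤ ‖c‖² / (8π⁴ν²)` for the state vector;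
* `exists_norm_stateVec_le` — the **`W` bound**: for `‖c‖ ≤ K` the state vector `x_u ∈ W`
  (coordinates `|k|² û(k)`) obeys `‖x_u‖ ≤ R(K, ‖M‖, ν)`, by the bootstrap
  `x = (4π²ν)⁻¹ (Y c − D_M x − B(x,x))` with the drift, bilinear and Agmon estimates of tools A.

References: Temam 1979 Ch. II §1 (Thm. 1.2 a priori estimates, Prop. 1.1 regularity);
Foias–Temam, CPAM 30 (1977) §1; Constantin–Foias 1988 Ch. 10.
-/

noncomputable section

-- D-0017: single-problem summit ⇒ the duplicated namespace segment is by design.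
set_option linter.dupNamespace false

open scoped BigOperators Topology ENNReal NNReal InnerProductSpace ComplexConjugate
open Filter Set Function TopologicalSpace MeasureTheory UnitAddTorus
open Literature.Analysis.FunctionSpaces Literature.Analysis.FunctionSpaces.Torus
open Literature.Analysis.FunctionSpaces.EuclideanSpace
open Literature.Analysis.FluidPDE Literature.Analysis.FluidPDE.Torus
open Literature.Analysis.FluidPDE.ScalarFourier
open Literature.Analysis.FluidPDE.SteadyLattice Literature.Analysis.FluidPDE.SteadyLatticeDrift

namespace Summit.AnomalousDissipation.AnomalousDissipation.Theorems.WindLineWindyGalerkinSteadyZerothLaw.GenericLeaf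

/-- The flat three-torus (local notation). -/
local notation "𝕋³" => UnitAddTorus (Fin 3)
/-- Velocity values (local notation). -/
local notation "E³" => EuclideanSpace ℝ (Fin 3)
/-- Complex coefficient vectors (local notation). -/
local notation "ℂ³" => EuclideanSpace ℂ (Fin 3)
/-- Square-summable coefficient families `ℤ³ → ℂ³` (local notation). -/
local notation "ℓ2" => lp (fun _ : Fin 3 → ℤ => EuclideanSpace ℂ (Fin 3)) 2
/-- Physical coefficients `x̌(k) = x(k)/|k|²` of a family (local notation, the tree's `cf`). -/
local notation "cf[" X "]" =>
  ((fun mm : Fin 3 → ℤ => (((freqNormSq mm)⁻¹ : ℝ) : ℂ)) • (X : (Fin 3 → ℤ) → EuclideanSpace ℂ (Fin 3)))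
/-- `k · v = ∑ⱼ kⱼ vⱼ` (local notation, the tree's `kdot`). -/
local notation "kdot[" k "," v "]" =>
  (∑ jj : Fin 3, (((k : Fin 3 → ℤ) jj : ℤ) : ℂ) * (v : EuclideanSpace ℂ (Fin 3)) jj)
/-- The convective symbol `N(a, b)(k)` as a vector of `ℂ³` (local notation, the tree's `nl`). -/
local notation "nl[" a "," b "," k "]" =>
  ((WithLp.toLp 2 (fun pp : Fin 3 => transportSym (fun jj mm => (a : (Fin 3 → ℤ) → EuclideanSpace ℂ (Fin 3)) mm jj)
    (fun mm => (b : (Fin 3 → ℤ) → EuclideanSpace ℂ (Fin 3)) mm pp) k)) : EuclideanSpace ℂ (Fin 3))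
set_option quotPrecheck false in
/-- admissible parameters -/
local notation "𝒜" => ({c : SymL2 (Fin 3) | c 0 = 0 ∧
  ∀ k : Fin 3 → ℤ, ∑ j : Fin 3, ((k j : ℤ) : ℂ) * c k j = 0} : Set (SymL2 (Fin 3)))
/-- the force of a parameter -/
local notation "F⟦" c "⟧" => SymL2.field (fun k : Fin 3 → ℤ => Real.exp (freqNormSq k)) (c : SymL2 (Fin 3))

/-! ## §1 The energy identity and the `H¹` bound -/

/-- **Energy identity of steady states**: `ν ‖∇v‖₂² = ∫ ⟪g, v⟫` (the kinetic energy of a constant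
path has derivative `0 = −ν‖∇v‖² + ∫⟪g, v⟫`, `IsClassicalNSSolutionOn.energy_balance_holds`). [folklore] -/
theorem steady_energy_identity {ν : ℝ} {g v : 𝕋³ → E³} {p : 𝕋³ → ℝ} (hv : IsSteadyNSState ν g v p) :
    ν * gradNormSq v = ∫ x, ⟪g x, v x⟫_ℝ := by
  have h1 : HasDerivWithinAt (fun s : ℝ => kineticEnergy ((fun _ : ℝ => v) s))
      (-ν * gradNormSq v + ∫ x, ⟪g x, v x⟫_ℝ) univ 0 :=
    IsClassicalNSSolutionOn.energy_balance_holds hv convex_univ (mem_univ 0)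
  have h2 : HasDerivAt (fun _ : ℝ => kineticEnergy v) (-ν * gradNormSq v + ∫ x, ⟪g x, v x⟫_ℝ) 0 :=
    h1.hasDerivAt univ_mem
  have h3 : HasDerivAt (fun _ : ℝ => kineticEnergy v) 0 0 := hasDerivAt_const 0 _
  have h := h3.unique h2
  linarith

/-- A steady state is smooth. [folklore] -/
theorem steady_isSmooth {ν : ℝ} {g v : 𝕋³ → E³} {p : 𝕋³ → ℝ} (hv : IsSteadyNSState ν g v p) : IsSmooth v :=
  hv.smooth_velocity.isSmooth_slice (mem_univ (0 : ℝ))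

/-- A steady state is divergence free. [folklore] -/
theorem steady_isDivFree {ν : ℝ} {g v : 𝕋³ → E³} {p : 𝕋³ → ℝ} (hv : IsSteadyNSState ν g v p) : IsDivFree v :=
  hv.divFree 0 (mem_univ _)

/-- `∑ₖ ‖𝓕F⟦c⟧(k)‖² ≤ ‖c‖²` as a real sum (with summability). [folklore] -/
theorem summable_norm_sq_mFourierCoeff_force (c : SymL2 (Fin 3)) :
    Summable (fun k => ‖mFourierCoeff (complexify ∘ F⟦c⟧) k‖ ^ 2) ∧
      ∑' k, ‖mFourierCoeff (complexify ∘ F⟦c⟧) k‖ ^ 2 ≤ ‖c‖ ^ 2 := by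
  have hs := SymL2.hasSum_norm_sq c
  have hle : ∀ k, ‖mFourierCoeff (complexify ∘ F⟦c⟧) k‖ ^ 2 ≤ ‖c k‖ ^ 2 := fun k => by
    rw [mFourierCoeff_force]
    exact pow_le_pow_left₀ (norm_nonneg _) (norm_coef_le c k) 2
  have hsum : Summable (fun k => ‖mFourierCoeff (complexify ∘ F⟦c⟧) k‖ ^ 2) :=
    Summable.of_nonneg_of_le (fun k => sq_nonneg _) hle hs.summable
  exact ⟨hsum, (Summable.tsum_le_tsum hle hsum hs.summable).trans (le_of_eq hs.tsum_eq)⟩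

/-- `∑ₖ |k|² ‖û(k)‖² = ‖∇u‖₂² / 4π²` as a real sum (with summability), for smooth `u`. [folklore] -/
theorem summable_freqNormSq_mul_norm_sq {u : 𝕋³ → E³} (hu : IsSmooth u) :
    Summable (fun k => freqNormSq k * ‖mFourierCoeff (complexify ∘ u) k‖ ^ 2) ∧
      ∑' k, freqNormSq k * ‖mFourierCoeff (complexify ∘ u) k‖ ^ 2 = (4 * Real.pi ^ 2)⁻¹ * gradNormSq u := by
  set a : (Fin 3 → ℤ) → ℂ³ := mFourierCoeff (complexify ∘ u) with ha
  have har : RapidDecay a := hu.complexify_comp.rapidDecay_mFourierCoeff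
  -- summability: `|k|² ‖a k‖² ≤ (1 + |k|²) ‖a k‖ · T`, `T = ∑ ‖a j‖`
  have hT := har.summable_norm
  have hbd : ∀ k, ‖a k‖ ≤ ∑' j, ‖a j‖ := fun k => hT.le_tsum k (fun j _ => norm_nonneg _)
  have h1 := (har 1).mul_right (∑' j, ‖a j‖)
  have hsum : Summable (fun k => freqNormSq k * ‖a k‖ ^ 2) := by
    refine Summable.of_nonneg_of_le (fun k => mul_nonneg (freqNormSq_nonneg k) (sq_nonneg _)) (fun k => ?_) h1
    rw [pow_one]
    have h0 : 0 ≤ (1 + freqNormSq k) * ‖a k‖ := mul_nonneg (by linarith [freqNormSq_nonneg k]) (norm_nonneg _)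
    have h2 : freqNormSq k * ‖a k‖ ^ 2 ≤ (1 + freqNormSq k) * ‖a k‖ * ‖a k‖ := by
      nlinarith [norm_nonneg (a k), freqNormSq_nonneg k]
    exact h2.trans (mul_le_mul_of_nonneg_left (hbd k) h0)
  refine ⟨hsum, ?_⟩
  have h := tsum_freqNormSq_mul_enorm_sq_mFourierCoeff_complexify hu
  have e : ∑' k, ENNReal.ofReal (freqNormSq k) * ‖a k‖ₑ ^ 2 = ∑' k, ENNReal.ofReal (freqNormSq k * ‖a k‖ ^ 2) :=
    tsum_congr fun k => by
      rw [← ofReal_norm, ← ENNReal.ofReal_pow (norm_nonneg _), ← ENNReal.ofReal_mul (freqNormSq_nonneg k)]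
  rw [← ha, e, ← ENNReal.ofReal_tsum_of_nonneg (fun k => mul_nonneg (freqNormSq_nonneg k) (sq_nonneg _)) hsum] at h
  exact (ENNReal.ofReal_eq_ofReal_iff (tsum_nonneg fun k => mul_nonneg (freqNormSq_nonneg k) (sq_nonneg _))
    (mul_nonneg (inv_nonneg.2 (by positivity)) (gradNormSq_nonneg u))).1 h

/-- **The `H¹` bound for steady states of `NS_ν(F⟦c⟧)`**: `‖∇u‖₂² ≤ ‖c‖² / (4π²ν²)`.  From the
energy identity, Parseval `∫⟪f,u⟫ = ∑ Re⟪f̂(k), û(k)⟫`, `f̂(0) = 0`, `|k| ≥ 1` off the origin and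
Cauchy–Schwarz: `ν‖∇u‖² ≤ ‖f̂‖_{ℓ²} (∑|k|²‖û(k)‖²)^{1/2} = ‖f̂‖_{ℓ²} ‖∇u‖/(2π)`. [folklore] -/
theorem gradNormSq_le_of_steady {ν : ℝ} (hν : 0 < ν) (c : 𝒜) {u : 𝕋³ → E³} {p : 𝕋³ → ℝ}
    (hst : IsSteadyNSState ν F⟦c⟧ u p) : gradNormSq u ≤ ‖(c : SymL2 (Fin 3))‖ ^ 2 / (4 * Real.pi ^ 2 * ν ^ 2) := by
  have hu : IsSmooth u := steady_isSmooth hst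
  have hfs : IsSmooth F⟦c⟧ := forceDict_isSmooth (c : SymL2 (Fin 3))
  obtain ⟨h0, -⟩ := c.2
  set f : (Fin 3 → ℤ) → ℝ := fun k => ‖mFourierCoeff (complexify ∘ F⟦c⟧) k‖ with hf
  set g : (Fin 3 → ℤ) → ℝ := fun k => Real.sqrt (freqNormSq k) * ‖mFourierCoeff (complexify ∘ u) k‖ with hg
  obtain ⟨hfs2, hfle⟩ := summable_norm_sq_mFourierCoeff_force (c : SymL2 (Fin 3))
  obtain ⟨hgs2, hgeq⟩ := summable_freqNormSq_mul_norm_sq hu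
  have hg2 : ∀ k, g k ^ 2 = freqNormSq k * ‖mFourierCoeff (complexify ∘ u) k‖ ^ 2 := fun k => by
    rw [hg]; dsimp only; rw [mul_pow, Real.sq_sqrt (freqNormSq_nonneg k)]
  have hgs2' : Summable fun k => g k ^ 2 := by simp_rw [hg2]; exact hgs2
  -- termwise: `Re⟪f̂ k, û k⟫ ≤ f k * g k`
  have hterm : ∀ k, RCLike.re ⟪mFourierCoeff (complexify ∘ F⟦c⟧) k, mFourierCoeff (complexify ∘ u) k⟫_ℂ ≤ f k * g k := by
    intro k
    by_cases hk : k = 0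
    · subst hk
      have hz : mFourierCoeff (complexify ∘ F⟦c⟧) 0 = 0 := by
        rw [mFourierCoeff_force, SymL2.coef_apply, h0, smul_zero]
      simp [hf, hg, hz]
    · refine (re_inner_le_norm _ _).trans ?_
      simp only [hf, hg]
      rw [← mul_assoc, mul_comm ‖_‖ (Real.sqrt _), mul_assoc]
      refine le_mul_of_one_le_left (mul_nonneg (norm_nonneg _) (norm_nonneg _)) ?_
      rw [← Real.sqrt_one]
      exact Real.sqrt_le_sqrt (one_le_freqNormSq' hk)
  -- Parseval + Hölder
  have hpar := hasSum_re_inner_mFourierCoeff_complexify (hfs.memLp 2) (hu.memLp 2)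
  have hf2s : Summable fun k => f k ^ 2 := hfs2
  have hH : ∑' k, f k * g k ≤ (∑' k, f k ^ 2) ^ (1 / (2 : ℝ)) * (∑' k, g k ^ 2) ^ (1 / (2 : ℝ)) := by
    have h := Real.inner_le_Lp_mul_Lq_tsum_of_nonneg (f := f) (g := g) Real.HolderConjugate.two_two
      (fun k => norm_nonneg _) (fun k => mul_nonneg (Real.sqrt_nonneg _) (norm_nonneg _))
      (by simpa [Real.rpow_two] using hf2s) (by simpa [Real.rpow_two] using hgs2')
    simpa [Real.rpow_two] using h
  have hfg : Summable fun k => f k * g k := by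
    refine Summable.of_nonneg_of_le (fun k => mul_nonneg (norm_nonneg _) (mul_nonneg (Real.sqrt_nonneg _)
      (norm_nonneg _))) (fun k => ?_) ((hf2s.add hgs2').div_const 2)
    have : f k * g k ≤ (f k ^ 2 + g k ^ 2) / 2 := by nlinarith [sq_nonneg (f k - g k)]
    exact this
  have hle1 : ∫ x, ⟪F⟦c⟧ x, u x⟫_ℝ ≤ ∑' k, f k * g k := hasSum_le hterm hpar hfg.hasSum
  have hF : (∑' k, f k ^ 2) ^ (1 / (2 : ℝ)) ≤ ‖(c : SymL2 (Fin 3))‖ := by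
    rw [← Real.sqrt_eq_rpow]
    calc Real.sqrt (∑' k, f k ^ 2) ≤ Real.sqrt (‖(c : SymL2 (Fin 3))‖ ^ 2) := Real.sqrt_le_sqrt hfle
      _ = ‖(c : SymL2 (Fin 3))‖ := Real.sqrt_sq (norm_nonneg _)
  have hG : (∑' k, g k ^ 2) ^ (1 / (2 : ℝ)) = Real.sqrt ((4 * Real.pi ^ 2)⁻¹ * gradNormSq u) := by
    rw [← Real.sqrt_eq_rpow, tsum_congr hg2, hgeq]
  -- `ν G ≤ ‖c‖ √(G/4π²)`, `G = ‖∇u‖²`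
  set G := gradNormSq u with hGdef
  have hG0 : 0 ≤ G := gradNormSq_nonneg u
  have hmain : ν * G ≤ ‖(c : SymL2 (Fin 3))‖ * Real.sqrt ((4 * Real.pi ^ 2)⁻¹ * G) := by
    rw [steady_energy_identity hst]
    refine hle1.trans (hH.trans ?_)
    rw [hG]
    exact mul_le_mul_of_nonneg_right hF (Real.sqrt_nonneg _)
  -- square and divide
  have hπ : (0 : ℝ) < 4 * Real.pi ^ 2 := by positivity
  rw [le_div_iff₀ (by positivity)]
  have hsq : (ν * G) ^ 2 ≤ ‖(c : SymL2 (Fin 3))‖ ^ 2 * ((4 * Real.pi ^ 2)⁻¹ * G) := by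
    calc (ν * G) ^ 2 ≤ (‖(c : SymL2 (Fin 3))‖ * Real.sqrt ((4 * Real.pi ^ 2)⁻¹ * G)) ^ 2 :=
          pow_le_pow_left₀ (mul_nonneg hν.le hG0) hmain 2
      _ = ‖(c : SymL2 (Fin 3))‖ ^ 2 * ((4 * Real.pi ^ 2)⁻¹ * G) := by
          rw [mul_pow, Real.sq_sqrt (mul_nonneg (inv_nonneg.2 hπ.le) hG0)]
  by_cases hGz : G = 0
  · rw [hGz, zero_mul]; positivity
  · have hGp : 0 < G := lt_of_le_of_ne hG0 (Ne.symm hGz)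
    have h' : ν ^ 2 * G * (4 * Real.pi ^ 2) ≤ ‖(c : SymL2 (Fin 3))‖ ^ 2 := by
      have := hsq
      rw [mul_pow] at this
      have h3 : ν ^ 2 * G ≤ ‖(c : SymL2 (Fin 3))‖ ^ 2 * (4 * Real.pi ^ 2)⁻¹ := by
        have h4 : ν ^ 2 * G * G ≤ ‖(c : SymL2 (Fin 3))‖ ^ 2 * (4 * Real.pi ^ 2)⁻¹ * G := by nlinarith
        exact le_of_mul_le_mul_right h4 hGp
      rw [← div_eq_mul_inv, le_div_iff₀ hπ] at h3
      exact h3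
    nlinarith

/-! ## §2 The `H¹` bound of the state vector and the `W` bound -/

/-- **`H¹` bound of the punctured family**: for smooth `u`, `‖û°‖²_{H¹} ≤ 2 ‖∇u‖₂² / 4π²`
(`⟨k⟩² ≤ 2|k|²` off the origin, Parseval for `∇u`). [folklore] -/
theorem eNormSq_one_update_le {u : 𝕋³ → E³} (hu : IsSmooth u) :
    Lattice.eNormSq 1 (Function.update (mFourierCoeff (complexify ∘ u)) 0 0) ≤
      ENNReal.ofReal (2 * ((4 * Real.pi ^ 2)⁻¹ * gradNormSq u)) := by
  rw [ENNReal.ofReal_mul (by norm_num : (0 : ℝ) ≤ 2), ← tsum_freqNormSq_mul_enorm_sq_mFourierCoeff_complexify hu,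
    ← ENNReal.tsum_mul_left, Lattice.eNormSq]
  refine ENNReal.tsum_le_tsum fun k => ?_
  by_cases hk : k = 0
  · subst hk; simp
  · rw [Function.update_of_ne hk]
    have hle : ENNReal.ofReal (sobolevWeight 1 k ^ 2) ≤ 2 * ENNReal.ofReal (freqNormSq k) := by
      rw [show (2 : ℝ≥0∞) = ENNReal.ofReal 2 by norm_num, ← ENNReal.ofReal_mul (by norm_num : (0 : ℝ) ≤ 2)]
      refine ENNReal.ofReal_le_ofReal ?_
      rw [sobolevWeight_one_sq]
      linarith [one_le_freqNormSq' hk]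
    rw [ENNReal.ofReal_ofNat, ← mul_assoc]
    exact mul_le_mul_left hle _

/-- **`H¹` bound of the state vector of a steady state**: `‖û°‖²_{H¹} ≤ ‖c‖² / (8π⁴ν²)`. [folklore] -/
theorem eNormSq_one_update_le_of_steady {ν : ℝ} (hν : 0 < ν) (c : 𝒜) {u : 𝕋³ → E³} {p : 𝕋³ → ℝ}
    (hst : IsSteadyNSState ν F⟦c⟧ u p) :
    Lattice.eNormSq 1 (Function.update (mFourierCoeff (complexify ∘ u)) 0 0) ≤
      ENNReal.ofReal (‖(c : SymL2 (Fin 3))‖ ^ 2 / (8 * Real.pi ^ 4 * ν ^ 2)) := by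
  refine (eNormSq_one_update_le (steady_isSmooth hst)).trans (ENNReal.ofReal_le_ofReal ?_)
  have h := gradNormSq_le_of_steady hν c hst
  have hπ : (0 : ℝ) < Real.pi := Real.pi_pos
  calc 2 * ((4 * Real.pi ^ 2)⁻¹ * gradNormSq u) ≤ 2 * ((4 * Real.pi ^ 2)⁻¹ *
        (‖(c : SymL2 (Fin 3))‖ ^ 2 / (4 * Real.pi ^ 2 * ν ^ 2))) := by gcongr
    _ = ‖(c : SymL2 (Fin 3))‖ ^ 2 / (8 * Real.pi ^ 4 * ν ^ 2) := by
        field_simp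
        ring

/-- From `X ≤ α + β √X` (`X, β ≥ 0`) to `X ≤ 2α + β²`. [folklore] -/
theorem le_of_le_add_mul_sqrt {X α β : ℝ} (hX : 0 ≤ X) (h : X ≤ α + β * Real.sqrt X) :
    X ≤ 2 * α + β ^ 2 := by
  nlinarith [sq_nonneg (Real.sqrt X - β), Real.sq_sqrt hX, Real.sqrt_nonneg X]

section WBound

variable {W : Submodule ℝ ℓ2}
variable (hW : ∀ x : ℓ2, x ∈ W ↔ (((x : ℓ2) : (Fin 3 → ℤ) → ℂ³) 0 = 0 ∧
  (∀ kk : Fin 3 → ℤ, kdot[kk, ((x : ℓ2) : (Fin 3 → ℤ) → ℂ³) kk] = 0) ∧ IsConjSymm ((x : ℓ2) : (Fin 3 → ℤ) → ℂ³)))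
variable (B : W → W → W)
variable (hB : ∀ x y : W, (((B x y : W) : ℓ2) : (Fin 3 → ℤ) → ℂ³) = fun k =>
  lerayCoeff k nl[cf[((x : ℓ2) : (Fin 3 → ℤ) → ℂ³)], cf[((y : ℓ2) : (Fin 3 → ℤ) → ℂ³)], k])
variable {M : ℂ³} (D : W →L[ℝ] W)
variable (hD : ∀ x : W, (((D x : W) : ℓ2) : (Fin 3 → ℤ) → ℂ³) = fun k =>
  (2 * Real.pi * Complex.I * kdot[k, M]) • cf[((x : ℓ2) : (Fin 3 → ℤ) → ℂ³)] k)

/-- Real form of an `ℝ≥0∞` norm bound: `‖z‖ₑ ≤ ofReal r` with `0 ≤ r` gives `‖z‖ ≤ r`. [folklore] -/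
theorem norm_le_of_enorm_le {z : W} {r : ℝ} (hr : 0 ≤ r) (h : ‖z‖ₑ ≤ ENNReal.ofReal r) : ‖z‖ ≤ r := by
  rw [← ofReal_norm] at h
  exact (ENNReal.ofReal_le_ofReal_iff hr).1 h

include hW hB hD in
/-- **The `W` bound for steady states** (Temam 1979 Ch. II §1: a priori `H²` estimate at fixed
viscosity, on the Fourier lattice).  For `ν > 0` and `K ≥ 0` there is `R` such that for every
`c ∈ 𝒜` with `‖c‖ ≤ K` and every classical steady state `(u, p)` of `NS_ν(F⟦c⟧)` with `û(0) = M`,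
the state vector `x` (coordinates `|k|² û(k)`) has `‖x‖ ≤ R`.  Proof: `x = (4π²ν)⁻¹(Y c − D x − B(x,x))`
with `‖Y c‖ ≤ ‖c‖`, `‖D x‖ ≤ 6π‖M‖ ‖û°‖_{H¹}`, `‖B(x,x)‖ ≤ 18π (∑‖û°‖) ‖û°‖_{H¹}`, the Agmon
interpolation `(∑‖û°‖)² ≤ C_A ‖û°‖_{H¹} ‖x‖` and the `H¹` bound `‖û°‖²_{H¹} ≤ K²/(8π⁴ν²)`, which give
`‖x‖ ≤ α + β‖x‖^{1/2}`. [folklore] -/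
theorem exists_norm_stateVec_le {ν : ℝ} (hν : 0 < ν) (K : ℝ) : ∃ R : ℝ, ∀ (c : 𝒜), ‖(c : SymL2 (Fin 3))‖ ≤ K → ∀ (u : 𝕋³ → E³) (p : 𝕋³ → ℝ),
      IsSteadyNSState ν F⟦c⟧ u p → mFourierCoeff (complexify ∘ u) 0 = M → ∀ x : W,
        (((x : ℓ2) : (Fin 3 → ℤ) → ℂ³) = fun k => ((freqNormSq k : ℝ) : ℂ) • mFourierCoeff (complexify ∘ u) k) →
        ‖x‖ ≤ R := by
  obtain ⟨CA, hCAtop, hA⟩ := exists_agmon_const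
  obtain ⟨Y, hY, hYn, -⟩ := exists_forceVecMap hW
  set cν : ℝ := 4 * Real.pi ^ 2 * ν with hcν
  have hcν0 : 0 < cν := by positivity
  set K' : ℝ := max K 0 with hK'
  have hK'0 : 0 ≤ K' := le_max_right _ _
  set h₀ : ℝ := K' ^ 2 / (8 * Real.pi ^ 4 * ν ^ 2) with hh₀
  have hh₀0 : 0 ≤ h₀ := by positivity
  set Ca : ℝ := CA.toReal with hCa
  have hCa0 : 0 ≤ Ca := ENNReal.toReal_nonneg
  set α : ℝ := cν⁻¹ * (K' + 6 * Real.pi * ‖M‖ * Real.sqrt h₀) with hα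
  set β : ℝ := cν⁻¹ * (18 * Real.pi * Real.sqrt h₀ * Real.sqrt (Ca * Real.sqrt h₀)) with hβ
  refine ⟨2 * α + β ^ 2, fun c hcK u p hst hM x hx => ?_⟩
  have hcK' : ‖(c : SymL2 (Fin 3))‖ ≤ K' := hcK.trans (le_max_left _ _)
  have hu : IsSmooth u := steady_isSmooth hst
  have hcf : cf[((x : ℓ2) : (Fin 3 → ℤ) → ℂ³)] = Function.update (mFourierCoeff (complexify ∘ u)) 0 0 := by
    rw [hx]; exact cf_weight_smul' _
  -- the equation and the `H¹` bound
  have heq := steadyMap_stateVec_eq B hB D hD hst hM x hx (Y c) (hY c)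
  have hH1 : Lattice.eNormSq 1 cf[((x : ℓ2) : (Fin 3 → ℤ) → ℂ³)] ≤ ENNReal.ofReal h₀ := by
    rw [hcf]
    refine (eNormSq_one_update_le_of_steady hν c hst).trans (ENNReal.ofReal_le_ofReal ?_)
    rw [hh₀]
    gcongr
  have hH1s : (Lattice.eNormSq 1 cf[((x : ℓ2) : (Fin 3 → ℤ) → ℂ³)]) ^ (1 / 2 : ℝ) ≤ ENNReal.ofReal (Real.sqrt h₀) := by
    rw [Real.sqrt_eq_rpow, ← ENNReal.ofReal_rpow_of_nonneg hh₀0 (by norm_num)]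
    exact ENNReal.rpow_le_rpow hH1 (by norm_num)
  -- the drift
  have hDx : ‖D x‖ ≤ 6 * Real.pi * ‖M‖ * Real.sqrt h₀ := by
    refine norm_le_of_enorm_le (by positivity) ((enorm_D_le D hD x).trans ?_)
    calc ENNReal.ofReal (6 * Real.pi * ‖M‖) * (Lattice.eNormSq 1 cf[((x : ℓ2) : (Fin 3 → ℤ) → ℂ³)]) ^ (1 / 2 : ℝ)
        ≤ ENNReal.ofReal (6 * Real.pi * ‖M‖) * ENNReal.ofReal (Real.sqrt h₀) := mul_le_mul_right hH1s _
      _ = ENNReal.ofReal (6 * Real.pi * ‖M‖ * Real.sqrt h₀) := by rw [← ENNReal.ofReal_mul (by positivity)]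
  -- the `ℓ¹` sum via Agmon
  have hxe : ‖(x : ℓ2)‖ₑ = ENNReal.ofReal ‖x‖ := by rw [← ofReal_norm]; rfl
  have hL : (∑' m, ‖cf[((x : ℓ2) : (Fin 3 → ℤ) → ℂ³)] m‖ₑ) ≤ ENNReal.ofReal (Real.sqrt (Ca * Real.sqrt h₀ * ‖x‖)) := by
    have h2 : (∑' m, ‖cf[((x : ℓ2) : (Fin 3 → ℤ) → ℂ³)] m‖ₑ) ^ 2 ≤ ENNReal.ofReal (Ca * Real.sqrt h₀ * ‖x‖) := by
      refine (hA (x : ℓ2)).trans ?_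
      calc CA * (Lattice.eNormSq 1 cf[((x : ℓ2) : (Fin 3 → ℤ) → ℂ³)]) ^ (1 / 2 : ℝ) * ‖(x : ℓ2)‖ₑ
          ≤ ENNReal.ofReal Ca * ENNReal.ofReal (Real.sqrt h₀) * ENNReal.ofReal ‖x‖ := by
            rw [hCa, ENNReal.ofReal_toReal hCAtop, hxe]
            exact mul_le_mul_left (mul_le_mul_right hH1s _) _
        _ = ENNReal.ofReal (Ca * Real.sqrt h₀ * ‖x‖) := by
            rw [← ENNReal.ofReal_mul hCa0, ← ENNReal.ofReal_mul (by positivity)]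
    calc (∑' m, ‖cf[((x : ℓ2) : (Fin 3 → ℤ) → ℂ³)] m‖ₑ)
        = ((∑' m, ‖cf[((x : ℓ2) : (Fin 3 → ℤ) → ℂ³)] m‖ₑ) ^ 2) ^ (1 / 2 : ℝ) := by
          rw [← ENNReal.rpow_natCast, ← ENNReal.rpow_mul]; norm_num
      _ ≤ (ENNReal.ofReal (Ca * Real.sqrt h₀ * ‖x‖)) ^ (1 / 2 : ℝ) := ENNReal.rpow_le_rpow h2 (by norm_num)
      _ = ENNReal.ofReal (Real.sqrt (Ca * Real.sqrt h₀ * ‖x‖)) := by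
          rw [ENNReal.ofReal_rpow_of_nonneg (by positivity) (by norm_num), ← Real.sqrt_eq_rpow]
  -- the bilinear term
  have hBx : ‖B x x‖ ≤ 18 * Real.pi * Real.sqrt (Ca * Real.sqrt h₀ * ‖x‖) * Real.sqrt h₀ := by
    refine norm_le_of_enorm_le (by positivity) ((enorm_B_le B hB x x).trans ?_)
    calc ENNReal.ofReal (18 * Real.pi) * (∑' m, ‖cf[((x : ℓ2) : (Fin 3 → ℤ) → ℂ³)] m‖ₑ) *
          (Lattice.eNormSq 1 cf[((x : ℓ2) : (Fin 3 → ℤ) → ℂ³)]) ^ (1 / 2 : ℝ)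
        ≤ ENNReal.ofReal (18 * Real.pi) * ENNReal.ofReal (Real.sqrt (Ca * Real.sqrt h₀ * ‖x‖)) *
            ENNReal.ofReal (Real.sqrt h₀) := mul_le_mul' (mul_le_mul_right hL _) hH1s
      _ = ENNReal.ofReal (18 * Real.pi * Real.sqrt (Ca * Real.sqrt h₀ * ‖x‖) * Real.sqrt h₀) := by
            rw [← ENNReal.ofReal_mul (by positivity), ← ENNReal.ofReal_mul (by positivity)]
  -- the bootstrap
  have hxid : x = cν⁻¹ • (Y c - D x - B x x) := by
    rw [← heq, smul_sub, smul_sub]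
    rw [show cν⁻¹ • (cν • x + D x + B x x) = x + cν⁻¹ • D x + cν⁻¹ • B x x by
      rw [smul_add, smul_add, smul_smul, inv_mul_cancel₀ hcν0.ne', one_smul]]
    abel
  have hxle : ‖x‖ ≤ cν⁻¹ * (‖Y c‖ + ‖D x‖ + ‖B x x‖) := by
    conv_lhs => rw [hxid]
    rw [norm_smul, Real.norm_of_nonneg (inv_nonneg.2 hcν0.le)]
    refine mul_le_mul_of_nonneg_left ?_ (inv_nonneg.2 hcν0.le)
    exact (norm_sub_le _ _).trans (add_le_add (norm_sub_le _ _) le_rfl)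
  have hfinal : ‖x‖ ≤ α + β * Real.sqrt ‖x‖ := by
    have hY' : ‖Y c‖ ≤ K' := (hYn c).trans hcK'
    have hsq : Real.sqrt (Ca * Real.sqrt h₀ * ‖x‖) = Real.sqrt (Ca * Real.sqrt h₀) * Real.sqrt ‖x‖ :=
      Real.sqrt_mul (by positivity) _
    rw [hsq] at hBx
    rw [hα, hβ]
    have hi : 0 ≤ cν⁻¹ := inv_nonneg.2 hcν0.le
    calc ‖x‖ ≤ cν⁻¹ * (‖Y c‖ + ‖D x‖ + ‖B x x‖) := hxle
      _ ≤ cν⁻¹ * (K' + 6 * Real.pi * ‖M‖ * Real.sqrt h₀ +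
            18 * Real.pi * (Real.sqrt (Ca * Real.sqrt h₀) * Real.sqrt ‖x‖) * Real.sqrt h₀) := by
          gcongr
      _ = _ := by ring
  exact le_of_le_add_mul_sqrt (norm_nonneg _) hfinal

end WBound

/-! ## §3 Registered sub-goal -/

/-- **Registered sub-goal `genericLeaf_toolsD`** (worker B of stub `stub_genericLeafNondegeneracy`): the
`W` bound for state vectors of classical steady states of `NS_ν(F⟦c⟧)`, `exists_norm_stateVec_le` in
Pi-form. [folklore] -/
theorem genericLeaf_toolsD : ∀ (W : Submodule ℝ ℓ2), (∀ x : ℓ2, x ∈ W ↔ (((x : ℓ2) : (Fin 3 → ℤ) → ℂ³) 0 = 0 ∧ (∀ kk : Fin 3 → ℤ, kdot[kk, ((x : ℓ2) : (Fin 3 → ℤ) → ℂ³) kk] = 0) ∧ IsConjSymm ((x : ℓ2) : (Fin 3 → ℤ) → ℂ³))) → ∀ (B : W → W → W), (∀ x y : W, (((B x y : W) : ℓ2) : (Fin 3 → ℤ) → ℂ³) = fun k => lerayCoeff k nl[cf[((x : ℓ2) : (Fin 3 → ℤ) → ℂ³)], cf[((y : ℓ2) : (Fin 3 → ℤ) →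 ℂ³)], k]) → ∀ (M : ℂ³) (D : W →L[ℝ] W), (∀ x : W, (((D x : W) : ℓ2) : (Fin 3 → ℤ) → ℂ³) = fun k => (2 * Real.pi * Complex.I * kdot[k, M]) • cf[((x : ℓ2) : (Fin 3 → ℤ) → ℂ³)] k) → ∀ (ν : ℝ), 0 < ν → ∀ K : ℝ, ∃ R : ℝ, ∀ (c : 𝒜), ‖(c : SymL2 (Fin 3))‖ ≤ K → ∀ (u : 𝕋³ → E³) (p : 𝕋³ → ℝ), IsSteadyNSState ν F⟦c⟧ u p → mFourierCoeff (complexify ∘ u) 0 = M → ∀ x : W, (((x : ℓ2) : (Fin 3 → ℤ) → ℂ³) = fun k => ((freqNormSq k : ℝ) : ℂ) • mFourierCoeff (complexify ∘ u) k) → ‖x‖ ≤ R :=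
  fun _ hW B hB _ D hD _ hν K => exists_norm_stateVec_le hW B hB D hD hν K

end Summit.AnomalousDissipation.AnomalousDissipation.Theorems.WindLineWindyGalerkinSteadyZerothLaw.GenericLeaf

end
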